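import Summits.BirchSwinnertonDyer.BirchSwinnertonDyer.Theorems.PrintCf2RamifiedOffTYZTheoremAOrderTwoGlobal
import Literature.NumberTheory.ComplexMultiplication.EllipticUnits.NormCharacterArtinSymbol
import HarnessLib

/-!
# Route `PrintCf2`, crux stmt-BirchSwinnertonDyer-20509 `RamifiedOffTYZOfFacts`, THEOREM A's target (T2), first half: the image of
# `G = Gal(R/K(i, √l))` in `Cl(K)` is `Cl²` (`ζ₄ ∉ H`: the Artin symbol of `(√−n)` moves `ζ₄`), and the orbit of an `H`-rational pair under `G`
# has `g(K) = #Cl²` elements as soon as `Gal(H/K)` acts freely on it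
# (cell `bsd-print-cf2`, LEAD cruxlead-20509 g33, line `offtyz-v7`, lineage cycle 34; Theses-free, `def`-free, fact-free)

HONEST FRAMING (`--supports stmt-BirchSwinnertonDyer-20509`; theorems only, no `sorry`, no new named fact).  BSD is not proved by any of this;
no class is closed by this file; item 23431 (C⁺) and crux 20509 stay OPEN.  Target (T2) of THEOREM A's road (`TheoremATargets.orbitProd_sq_of_targets`,
p812073) is «`#G•a₀ = g(K)`».  This file supplies its Galois-theoretic half; the Heegner half (freeness of `Gal(H/K)` on the point `(a, b) ∈ A(H)`, fibre
count `1 ⟹ Stab_G(a₀) = Stab_G(a₀, b₀)`) is the sequel.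

* §1 `coe_artinSymbol_autToPow_eq_absNorm`, ★ `artinSymbol_apply_eq_pow_absNorm` — **`(𝔞, R/K) ζ = ζ^{N𝔞}`** for a primitive `m`-th root of unity
  `ζ ∈ R = rayClassField K 𝔪` and `𝔞 ≠ 0` all of whose prime factors avoid `m` (Frobenius `ζ ↦ ζ^{N𝔭}`, tree `galFrob_apply_eq_pow_absNorm`, multiplied
  out); `absNorm_span_singleton_of_sq_eq_neg` — `N((w)) = n` for `w² = −n`; ★ `artinSymbol_span_sqrt_apply_zeta_four` — for `n ≡ 3 (mod 4)` the Artin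
  symbol of the PRINCIPAL ideal `(w)` sends a fourth root of unity `ζ` to `−ζ` (`N(w) = n ≡ 3 (mod 4)`): **`ζ₄ ∉ H`** in the form the counting needs.
* §2 `exists_res_restrict` — the restriction `rH : Gal(R/K) →* Gal(H/K)` together with `res = artinEquiv⁻¹ ∘ rH : Gal(R/K) ↠ Cl(K)`: `g (h) = rH g (h)` on `H ⊆ R`,
  `res (𝔞, R/K) = [𝔞]`, `res` onto.
* §3 (group theory) `map_eq_map_of_exists_ker_neg` — if `G ≤ Stab(w)`, `Stab(w) ∩ Stab(i) ≤ G`, every element acts on `i` by `±1`, and some `c ∈ ker res` has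
  `c•i = −i`, `c•w = w`, then `res(G) = res(Stab w)`; with `TheoremAOrderTwoGroup.map_stabilizer_eq_range_sq`: `res(G) = Cl²`, of order `g(K)`.
* §4 (counting) `card_image_smul_eq_card_image_of_free` — an action through `ρ : G → A` with `A` acting freely at `x`: `#G•x = #ρ(G)`;
  `card_image_coe_eq_natCard_map` — `#{res g : g ∈ G} = #res(G)`.

References: [cite: TateGCFT1967, Ch. VII §3.4]; [cite: NeukirchANT1999, Ch. VI §7 (7.1)]; [folklore] group actions; tree p813336, p813802 (`exists_res`),
`NormCharacterArtinSymbol` (p784195).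
-/

noncomputable section

open scoped Classical nonZeroDivisors
open NumberField IsDedekindDomain MulAction Finset

namespace Summit.BirchSwinnertonDyer.PrintCf2.TheoremAOrbitCount

open Literature.NumberTheory.EllipticCurves Literature.NumberTheory.NumberFields Literature.NumberTheory.GaloisRepresentations
open Literature.NumberTheory.LFunctions.AbelianDensity (artinSymbol artinSymbol_mul artinSymbol_asIdeal)
open Literature.NumberTheory.ComplexMultiplication.EllipticUnits (artinSymbol_congr_of_dvd galFrob_apply_eq_pow_absNorm autToPow_galFrob_eq_absNorm)
open Summit.BirchSwinnertonDyer.PrintCf2.TheoremAHilbertBridge Summit.BirchSwinnertonDyer.PrintCf2.TheoremAOrderTwoGroup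
open Summit.BirchSwinnertonDyer.PrintCf2.TheoremAOrderTwoGlobal

variable {K : Type} [Field K] [NumberField K]

/-! ## §1 The Artin symbol on roots of unity: `(𝔞, R/K) ζ = ζ^{N𝔞}` -/

section Cyclotomic

variable {𝔪 : Ideal (𝓞 K)} {m : ℕ} [NeZero m] {ζ : rayClassField K 𝔪}

/-- `χ_cyc((𝔞, R/K)) = N𝔞 (mod m)` on ideals `𝔞 ≠ 0` whose prime factors avoid `m`, `χ_cyc = hζ.autToPow K` the cyclotomic character on `⟨ζ⟩ = μ_m`
(Frobenius `ζ ↦ ζ^{N𝔭}` multiplied along the factorisation of `𝔞`). [cite: TateGCFT1967, Ch. VII §3.4 Proposition] [cite: NeukirchANT1999, Ch. VI §7 (7.1)] -/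
theorem coe_artinSymbol_autToPow_eq_absNorm (hζ : IsPrimitiveRoot ζ m) {I : Ideal (𝓞 K)} (hI : I ≠ ⊥)
    (hm : ∀ v : HeightOneSpectrum (𝓞 K), v.asIdeal ∣ I → (m : 𝓞 K) ∉ v.asIdeal) :
    ((artinSymbol (fun v => hζ.autToPow K (galFrob K (rayClassField K 𝔪) v)) I : (ZMod m)ˣ) : ZMod m) = (Ideal.absNorm I : ZMod m) := by
  set f := fun v : HeightOneSpectrum (𝓞 K) => hζ.autToPow K (galFrob K (rayClassField K 𝔪) v) with hf
  induction I using UniqueFactorizationMonoid.induction_on_prime with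
  | h₁ => exact absurd rfl hI
  | h₂ J hJ =>
    have hJ' : J = ⊤ := Ideal.isUnit_iff.mp hJ
    subst hJ'
    have hsq : artinSymbol f (⊤ : Ideal (𝓞 K)) * artinSymbol f ⊤ = artinSymbol f ⊤ := by
      rw [← artinSymbol_mul f top_ne_bot top_ne_bot, Ideal.top_mul]
    rw [mul_eq_left.mp hsq, Units.val_one, Ideal.absNorm_top, Nat.cast_one]
  | h₃ J P hJ hP ih =>
    have hP' : P ≠ ⊥ := hP.ne_zero
    have hmJ : ∀ v : HeightOneSpectrum (𝓞 K), v.asIdeal ∣ J → (m : 𝓞 K) ∉ v.asIdeal := fun v hv => hm v (hv.mul_left P)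
    let v : HeightOneSpectrum (𝓞 K) := ⟨P, Ideal.isPrime_of_prime hP, hP'⟩
    have hv : artinSymbol f P = f v := artinSymbol_asIdeal f v
    rw [artinSymbol_mul f hP' hJ, Units.val_mul, map_mul, Nat.cast_mul, ih hJ hmJ, hv, hf]
    simp only
    rw [autToPow_galFrob_eq_absNorm hζ v (hm v (dvd_mul_right P J))]

/-- ★ **`(𝔞, R/K) ζ = ζ^{N𝔞}`** for a primitive `m`-th root of unity `ζ ∈ R = rayClassField K 𝔪` and `𝔞 ≠ 0` all of whose prime factors avoid `m`.
[cite: TateGCFT1967, Ch. VII §3.4 Proposition] [cite: NeukirchANT1999, Ch. VI §7 (7.1)] -/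
theorem artinSymbol_apply_eq_pow_absNorm (hζ : IsPrimitiveRoot ζ m) {I : Ideal (𝓞 K)} (hI : I ≠ ⊥)
    (hm : ∀ v : HeightOneSpectrum (𝓞 K), v.asIdeal ∣ I → (m : 𝓞 K) ∉ v.asIdeal) :
    artinSymbol (galFrob K (rayClassField K 𝔪)) I ζ = ζ ^ Ideal.absNorm I := by
  have hχ := Literature.NumberTheory.GaloisRepresentations.map_artinSymbol (hζ.autToPow K) (galFrob K (rayClassField K 𝔪)) hI
  have hval := coe_artinSymbol_autToPow_eq_absNorm hζ hI hm
  rw [← Function.comp_def, ← hχ] at hval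
  rw [← hζ.autToPow_spec K (artinSymbol (galFrob K (rayClassField K 𝔪)) I), hval, ZMod.val_natCast]
  conv_rhs => rw [← Nat.mod_add_div (Ideal.absNorm I) m]
  rw [pow_add, pow_mul, hζ.pow_eq_one, one_pow, mul_one]

end Cyclotomic

/-- `N((w)) = n` for `w ∈ 𝓞 K` with `w² = −n`, `K` quadratic. [folklore] -/
theorem absNorm_span_singleton_of_sq_eq_neg (hK : IsImaginaryQuadratic K) {n : ℕ} (w : 𝓞 K) (hw : w ^ 2 = -((n : ℕ) : 𝓞 K)) :
    Ideal.absNorm (Ideal.span {w}) = n := by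
  have h := congrArg Ideal.absNorm (show (Ideal.span {w}) ^ 2 = Ideal.span {((n : ℕ) : 𝓞 K)} by
    rw [Ideal.span_singleton_pow, hw, Ideal.span_singleton_neg])
  rw [map_pow, Ideal.absNorm_span_singleton, Ideal.absNorm_span_singleton] at h
  have hn : Algebra.norm ℤ ((n : ℕ) : 𝓞 K) = (n : ℤ) ^ 2 := by
    have h1 := Algebra.norm_algebraMap (S := 𝓞 K) (n : ℤ)
    rw [NumberField.RingOfIntegers.rank, hK.1] at h1
    rw [← h1]; simp
  rw [hn, Int.natAbs_pow, Int.natAbs_natCast] at h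
  rw [Ideal.absNorm_span_singleton]
  exact Nat.pow_left_injective two_ne_zero h

omit [NumberField K] in
/-- The prime factors of `(w)`, `w² = −n` with `n` odd, avoid `4`. [folklore] -/
theorem four_not_mem_of_dvd_span_sqrt {n : ℕ} (hn : Odd n) (w : 𝓞 K) (hw : w ^ 2 = -((n : ℕ) : 𝓞 K))
    (v : HeightOneSpectrum (𝓞 K)) (hv : v.asIdeal ∣ Ideal.span {w}) : ((4 : ℕ) : 𝓞 K) ∉ v.asIdeal := by
  intro h4
  have hw' : (w : 𝓞 K) ∈ v.asIdeal := by
    have := Ideal.le_of_dvd hv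
    exact this (Ideal.mem_span_singleton_self w)
  have hn' : ((n : ℕ) : 𝓞 K) ∈ v.asIdeal := by
    have h := v.asIdeal.mul_mem_left w hw'
    rw [← pow_two, hw] at h
    exact (Ideal.neg_mem_iff _).mp h
  -- `gcd(n, 4) = 1`
  obtain ⟨k, hk⟩ := hn
  have h1 : (1 : 𝓞 K) ∈ v.asIdeal := by
    have e : (1 : 𝓞 K) = ((n : ℕ) : 𝓞 K) * n - ((4 : ℕ) : 𝓞 K) * (k * k + k : ℕ) := by
      rw [hk]; push_cast; ring
    rw [e]
    exact v.asIdeal.sub_mem (v.asIdeal.mul_mem_right _ hn') (v.asIdeal.mul_mem_right _ h4)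
  exact v.isPrime.ne_top ((Ideal.eq_top_iff_one _).mpr h1)

/-- ★ **`ζ₄ ∉ H`, concretely**: for `w ∈ 𝓞 K` with `w² = −n`, `n ≡ 3 (mod 4)`, and `ζ ∈ R` a primitive fourth root of unity, the Artin symbol of the
PRINCIPAL ideal `(w)` maps `ζ` to `ζ^n = ζ³ = −ζ ≠ ζ`. [cite: TateGCFT1967, Ch. VII §3.4 Proposition] -/
theorem artinSymbol_span_sqrt_apply_zeta_four (hK : IsImaginaryQuadratic K) {𝔪 : Ideal (𝓞 K)} {ζ : rayClassField K 𝔪} (hζ : IsPrimitiveRoot ζ 4)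
    {n : ℕ} (hn : n % 4 = 3) (w : 𝓞 K) (hw : w ^ 2 = -((n : ℕ) : 𝓞 K)) :
    artinSymbol (galFrob K (rayClassField K 𝔪)) (Ideal.span {w}) ζ = -ζ := by
  have hw0 : (Ideal.span {w} : Ideal (𝓞 K)) ≠ ⊥ := by
    rw [Ne, Ideal.span_singleton_eq_bot]
    rintro rfl
    have : ((n : ℕ) : 𝓞 K) = 0 := by
      have h := hw; rw [zero_pow two_ne_zero] at h; exact (neg_eq_zero.mp h.symm)
    have hn0 : n ≠ 0 := by omega
    exact hn0 (by exact_mod_cast this)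
  rw [artinSymbol_apply_eq_pow_absNorm hζ hw0 (four_not_mem_of_dvd_span_sqrt (Nat.odd_iff.mpr (by omega)) w hw),
    absNorm_span_singleton_of_sq_eq_neg hK w hw]
  have h4 : ζ ^ 4 = 1 := hζ.pow_eq_one
  have h2 : ζ ^ 2 = -1 := by
    have hne : ζ ^ 2 ≠ 1 := hζ.pow_ne_one_of_pos_of_lt (by norm_num) (by norm_num)
    have hfac : (ζ ^ 2 - 1) * (ζ ^ 2 + 1) = 0 := by
      have : ζ ^ 4 - 1 = 0 := by rw [h4, sub_self]
      linear_combination this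
    rcases mul_eq_zero.mp hfac with h | h
    · exact absurd (sub_eq_zero.mp h) hne
    · exact eq_neg_of_add_eq_zero_left h
  conv_lhs => rw [← Nat.mod_add_div n 4, hn]
  rw [pow_add, pow_mul, h4, one_pow, mul_one, pow_succ, h2, neg_one_mul]

/-! ## §2 Restriction to the Hilbert class field, with the action on `H ⊆ R` -/

/-- **`rH : Gal(R/K) →* Gal(H/K)` and `res = artinEquiv⁻¹ ∘ rH`** (`R = rayClassField K 𝔪 ⊇ H`): `g` acts on `h ∈ H ⊆ R` through `rH g`; `res` is onto; `res`
of an Artin symbol is the class. [cite: NeukirchANT1999, Ch. VI §6 (6.9), §7 (7.1), (7.3)] [cite: Childress2009, Ch. 5 §1 Cor. 1.2] -/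
theorem exists_res_restrict {𝔪 : Ideal (𝓞 K)} (h𝔪 : 𝔪 ≠ ⊥) :
    ∃ (rH : (rayClassField K 𝔪 ≃ₐ[K] rayClassField K 𝔪) →* (hilbertClassField K ≃ₐ[K] hilbertClassField K))
      (res : (rayClassField K 𝔪 ≃ₐ[K] rayClassField K 𝔪) →* ClassGroup (𝓞 K)),
      (∀ g, res g = (hilbertClassField.artinEquiv K).symm (rH g)) ∧
      Function.Surjective res ∧
      (∀ g (h : hilbertClassField K), g (IntermediateField.inclusion (hilbertClassField_le_rayClassField h𝔪) h) =
        IntermediateField.inclusion (hilbertClassField_le_rayClassField h𝔪) (rH g h)) ∧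
      (∀ (I : Ideal (𝓞 K)) (hI : I ≠ ⊥), res (artinSymbol (galFrob K (rayClassField K 𝔪)) I) = ClassGroup.mk0 ⟨I, mem_nonZeroDivisors_of_ne_zero hI⟩) := by
  set H := hilbertClassField K with hHdef
  set R := rayClassField K 𝔪 with hRdef
  have hHR : H ≤ R := hilbertClassField_le_rayClassField h𝔪
  letI : Algebra H R := (IntermediateField.inclusion hHR).toRingHom.toAlgebra
  haveI : IsScalarTower K H R := isScalarTower_inclusion hHR
  let rH : (R ≃ₐ[K] R) →* (H ≃ₐ[K] H) := AlgEquiv.restrictNormalHom H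
  let res : (R ≃ₐ[K] R) →* ClassGroup (𝓞 K) := (hilbertClassField.artinEquiv K).symm.toMonoidHom.comp rH
  have hres : ∀ g, res g = (hilbertClassField.artinEquiv K).symm (rH g) := fun g => rfl
  refine ⟨rH, res, hres, ?_, ?_, ?_⟩
  · exact (hilbertClassField.artinEquiv K).symm.surjective.comp (AlgEquiv.restrictNormalHom_surjective R)
  · intro g h
    have hcomm := AlgEquiv.restrictNormal_commutes g H h
    rw [algebraMap_inclusion_apply hHR, algebraMap_inclusion_apply hHR] at hcomm
    exact hcomm.symm
  · intro I hI
    rw [Literature.NumberTheory.GaloisRepresentations.map_artinSymbol res _ hI,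
      artinSymbol_congr_of_dvd hI (g := fun v : HeightOneSpectrum (𝓞 K) => ClassGroup.mk0 ⟨v.asIdeal, asIdeal_mem_nonZeroDivisors v⟩)
        (fun v _ => ?_), artinSymbol_classGroupMk0 I hI]
    rw [Function.comp_apply, hres, MulEquiv.symm_apply_eq, hilbertClassField.artinEquiv_mk0_eq_galFrob]
    exact restrictNormalHom_galFrob_eq_galFrob_of_isUnramifiedIn (commute_of_isAbelianGalois H) (hilbertClassField.isUnramifiedIn K v)

/-! ## §3 Group theory: `res(G) = res(Stab w)` -/

section Group

variable {Γ A X : Type*} [CommGroup Γ] [CommGroup A] [AddCommGroup X] [DistribMulAction Γ X]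

/-- **`res(G) = res(Stab w)`** when `Stab(w) ∩ Stab(i) ≤ G ≤ Stab(w)`, every element acts on `i` by `±1`, and some `c ∈ ker res` NEGATES `i` while
fixing `w`: an `x ∈ Stab(w)` either fixes `i` (so `x ∈ G`) or `x·c` does, with `res (x c) = res x`. [folklore] -/
theorem map_eq_map_of_exists_ker_neg (res : Γ →* A) {G : Subgroup Γ} {w i : X} (hG : G ≤ stabilizer Γ w)
    (hG' : ∀ x : Γ, x • w = w → x • i = i → x ∈ G) (hi : ∀ x : Γ, x • i = i ∨ x • i = -i)
    (hc : ∃ c : Γ, res c = 1 ∧ c • i = -i ∧ c • w = w) : G.map res = (stabilizer Γ w).map res := by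
  obtain ⟨c, hc1, hci, hcw⟩ := hc
  apply le_antisymm (Subgroup.map_mono hG)
  rintro _ ⟨x, hx, rfl⟩
  have hx : x • w = w := mem_stabilizer_iff.mp hx
  rcases hi x with h | h
  · exact Subgroup.mem_map.mpr ⟨x, hG' x hx h, rfl⟩
  · refine Subgroup.mem_map.mpr ⟨x * c, hG' (x * c) ?_ ?_, by rw [map_mul, hc1, mul_one]⟩
    · rw [mul_smul, hcw, hx]
    · rw [mul_smul, hci, smul_neg, h, neg_neg]

end Group

/-! ## §4 Counting an orbit through a free quotient action -/

/-- **`#G•x = #ρ(G)`** when `G` acts on `x` through `ρ : G → A` and `A` acts FREELY at `x`. [folklore] -/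
theorem card_image_smul_eq_card_image_of_free {G A Y : Type*} [Group A] [MulAction A Y] [Fintype G] [DecidableEq Y] [DecidableEq A]
    (ρ : G → A) (x : Y) (act : G → Y) (hact : ∀ g, act g = ρ g • x) (hfree : ∀ a : A, a • x = x → a = 1) :
    ((univ : Finset G).image act).card = ((univ : Finset G).image ρ).card := by
  have h1 : (univ : Finset G).image act = ((univ : Finset G).image ρ).image (fun a => a • x) := by
    rw [Finset.image_image]
    exact Finset.image_congr fun g _ => by rw [Function.comp_apply, hact]
  rw [h1, card_image_of_injOn]
  intro a _ a' _ h
  have h2 : (a'⁻¹ * a) • x = x := by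
    have h' : a • x = a' • x := h
    rw [mul_smul, h', inv_smul_smul]
  exact (inv_mul_eq_one.mp (hfree _ h2)).symm

end Summit.BirchSwinnertonDyer.PrintCf2.TheoremAOrbitCount

end
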